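import Summits.AtomisticToContinuum.FouriersLaw.Theorems.VanishingNoiseTransferNoiseLocalityStubResponseDensityNoisyAux2
import Summits.AtomisticToContinuum.FouriersLaw.Theorems.OddSectorIrreversibilityOddDensityIsCorrectorResolvent
import Summits.AtomisticToContinuum.FouriersLaw.Theorems.BondHeatUncertaintySubdiffusiveBondHeatBathBondReductionDynkin
import Literature.MathematicalPhysics.KineticTheory.LangevinChainDynkin

/-!
# The equilibrium transition kernels on `L²(μ_T)`: Dynkin bound, contraction, exponential mixing
(helpers for stub `stub_responseDensityNoisy`)

Helper file `--supports stmt-AtomisticToContinuum-11975` (crux `NoiseLocality`, route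
`VanishingNoiseTransfer`, line `relative-flip-energy-transfer`, stub 1b `stub_responseDensityNoisy`).

`L²(μ_T)` facts about the transition kernels `P_t` of the pinned anharmonic chain at equal bath
temperatures `T` (`ω₂, β, γ, T > 0`, `lam ≥ 0`, `N ≥ 1`), assembled from the tree's kernel
infrastructure (Gibbs invariance `pinnedChain_gibbsMeasure_bind_transitionKernel`, the `L²(μ_T)`
contraction `pinnedChain_integral_sq_act_le`, Dynkin's identity `pinnedChain_dynkin` and its integrated
form `pinnedChain_integral_mul_act_sub_of_dynkin`, the Harris bound `pinnedChain_harris_bound`) — the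
semigroup inputs of the `L²(μ_T)`-Liouville theorem of the next file:

* `abs_integral_mul_le_sqrt_mul_sqrt` — Cauchy–Schwarz `|∫ f g| ≤ √∫f² √∫g²` for `L²` functions;
* `memLp_act_of_bounded` — `P_t F ∈ L²` for bounded continuous `F`;
* `integral_sq_act_sub_act_le` — `‖P_t F - P_t G‖₂ ≤ ‖F - G‖₂` for test functions;
* `exists_integral_sq_act_sub_mean_le` — `‖P_t F - μ_T(F)‖₂² ≤ K B² e^{-2ct}` for continuous `|F| ≤ B`;
* `integral_sq_act_sub_le` (registered helper `helper_responseDensityNoisyDynkinL2`) — **Dynkin in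
  `L²`**: `‖P_t F - F‖₂ ≤ t ‖L F‖₂` for `F ∈ C_c^∞`.

No definitions.
-/

noncomputable section

open MeasureTheory ProbabilityTheory Filter Topology Set
open scoped ContDiff NNReal InnerProductSpace

namespace Summit.AtomisticToContinuum.FouriersLaw.Theorems.NoiseLocality.StubResponseDensityNoisy

open Literature.MathematicalPhysics.KineticTheory.HeatConduction
open Summit.AtomisticToContinuum.FouriersLaw.Theorems.OddSectorIrreversibility
open Summit.AtomisticToContinuum.FouriersLaw.Theorems.SubdiffusiveBondHeat

variable {ω₂ lam β γ : ℝ} {N : ℕ} {T : ℝ}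

/-- **Cauchy–Schwarz** for the integral of a product of two `L²(μ)` functions. -/
theorem abs_integral_mul_le_sqrt_mul_sqrt (μ : Measure (PhaseSpace N)) {f g : PhaseSpace N → ℝ}
    (hf : MemLp f 2 μ) (hg : MemLp g 2 μ) :
    |∫ x, f x * g x ∂μ| ≤ Real.sqrt (∫ x, f x ^ 2 ∂μ) * Real.sqrt (∫ x, g x ^ 2 ∂μ) := by
  rw [← inner_toLp_toLp_eq_integral hf hg]
  refine (abs_real_inner_le_norm _ _).trans ?_
  exact mul_le_mul (norm_toLp_le_sqrt hf le_rfl) (norm_toLp_le_sqrt hg le_rfl) (norm_nonneg _)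
    (Real.sqrt_nonneg _)

/-- `P_t F ∈ L²` of every finite measure for bounded continuous `F` (`|P_t F| ≤ sup |F|`). -/
theorem memLp_act_of_bounded (hω : 0 < ω₂) (hl : 0 ≤ lam) (hβ : 0 < β) (hγ : 0 < γ)
    {F : PhaseSpace N → ℝ} (hF : Continuous F) {B : ℝ} (hB : ∀ y, ‖F y‖ ≤ B) (t : ℝ≥0)
    (μ : Measure (PhaseSpace N)) [IsFiniteMeasure μ] :
    MemLp (fun z => ∫ y, F y ∂((pinnedChain ω₂ lam β γ).transitionKernel N T T t z)) 2 μ :=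
  MemLp.of_bound
    (hF.stronglyMeasurable.integral_kernel
      (κ := (pinnedChain ω₂ lam β γ).transitionKernel N T T t)).aestronglyMeasurable B
    (Eventually.of_forall fun z => pinnedChain_abs_act_le_of_bounded hω hl hβ hγ hB t z)

/-- **`L²(μ_T)` contraction on differences of test functions**: `∫ (P_tF - P_tG)² dμ_T ≤ ∫ (F-G)² dμ_T`. -/
theorem integral_sq_act_sub_act_le (hω : 0 < ω₂) (hl : 0 ≤ lam) (hβ : 0 < β) (hγ : 0 < γ)
    (hN : 0 < N) (hT : 0 < T) {F G : PhaseSpace N → ℝ} (hF : ContDiff ℝ ∞ F)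
    (hFc : HasCompactSupport F) (hG : ContDiff ℝ ∞ G) (hGc : HasCompactSupport G) (t : ℝ≥0) :
    ∫ z, ((∫ y, F y ∂((pinnedChain ω₂ lam β γ).transitionKernel N T T t z)) -
        ∫ y, G y ∂((pinnedChain ω₂ lam β γ).transitionKernel N T T t z)) ^ 2
        ∂((pinnedChain ω₂ lam β γ).gibbsMeasure N T) ≤
      ∫ z, (F z - G z) ^ 2 ∂((pinnedChain ω₂ lam β γ).gibbsMeasure N T) := by
  set P := pinnedChain ω₂ lam β γ with hP
  haveI : IsMarkovKernel (P.transitionKernel N T T t) :=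
    pinnedChain_isMarkovKernel_transitionKernel hω hl hβ.le hγ.le N T T t
  have hDc : Continuous fun y => F y - G y := hF.continuous.sub hG.continuous
  have hDs : HasCompactSupport fun y => F y - G y := hFc.sub hGc
  obtain ⟨C, hC⟩ := hDc.bounded_above_of_compact_support hDs
  have hC0 : 0 ≤ C := (norm_nonneg _).trans (hC 0)
  have hϑ0 : 0 < 1 / (4 * T) := by positivity
  have h2ϑ : 2 * (1 / (4 * T)) < 1 / T := by
    rw [show (2 : ℝ) * (1 / (4 * T)) = 1 / (2 * T) by field_simp; ring]
    exact one_div_lt_one_div_of_lt hT (by linarith)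
  have hDb : ∀ y, |F y - G y| ≤ C * Real.exp (1 / (4 * T) * P.hamiltonian N y) := fun y =>
    ((Real.norm_eq_abs _).symm.le.trans (hC y)).trans
      (le_mul_of_one_le_right hC0 (pinnedChain_one_le_exp_mul_hamiltonian hω hl hβ hϑ0.le y))
  have h := (pinnedChain_integral_sq_act_le hω hl hβ hγ hN hT hϑ0 h2ϑ hDc hDb t).2.2
  refine le_trans (le_of_eq (integral_congr_ae (Eventually.of_forall fun z => ?_))) h
  have iF : Integrable F (P.transitionKernel N T T t z) := hF.continuous.integrable_of_hasCompactSupport hFc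
  have iG : Integrable G (P.transitionKernel N T T t z) := hG.continuous.integrable_of_hasCompactSupport hGc
  simp only
  rw [integral_sub iF iG]

/-- **Exponential mixing in `L²(μ_T)`**: there are `K, c > 0` with
`∫ (P_t F - μ_T(F))² dμ_T ≤ K B² e^{-2ct}` for every continuous `F` with `|F| ≤ B` and every `t ≥ 0`
(the Harris bound `|P_tF(z) - μ_T(F)| ≤ K' B e^{H(z)/4T} e^{-ct}` squared and integrated,
`e^{H/2T} ∈ L¹(μ_T)`). -/
theorem exists_integral_sq_act_sub_mean_le (hω : 0 < ω₂) (hl : 0 ≤ lam) (hβ : 0 < β) (hγ : 0 < γ)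
    (hN : 0 < N) (hT : 0 < T) :
    ∃ K c : ℝ, 0 < c ∧ ∀ (F : PhaseSpace N → ℝ), Continuous F → ∀ B : ℝ, 0 ≤ B →
      (∀ y, |F y| ≤ B) → ∀ t : ℝ≥0,
        ∫ z, ((∫ y, F y ∂((pinnedChain ω₂ lam β γ).transitionKernel N T T t z)) -
            ∫ y, F y ∂((pinnedChain ω₂ lam β γ).gibbsMeasure N T)) ^ 2
            ∂((pinnedChain ω₂ lam β γ).gibbsMeasure N T) ≤
          K * B ^ 2 * Real.exp (-(2 * c) * (t : ℝ)) := by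
  set P := pinnedChain ω₂ lam β γ with hP
  set π := P.gibbsMeasure N T with hπ_def
  have hϑ0 : 0 < 1 / (4 * T) := by positivity
  have hϑ1 : 1 / (4 * T) < 1 / T := one_div_lt_one_div_of_lt hT (by linarith)
  have h2ϑ : 2 * (1 / (4 * T)) < 1 / T := by
    rw [show (2 : ℝ) * (1 / (4 * T)) = 1 / (2 * T) by field_simp; ring]
    exact one_div_lt_one_div_of_lt hT (by linarith)
  obtain ⟨K, c, hK, hc, hb⟩ := pinnedChain_harris_bound hω hl hβ hγ hN hT hϑ0 hϑ1
  have hI : Integrable (fun z => Real.exp (2 * (1 / (4 * T)) * P.hamiltonian N z)) π :=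
    pinnedChain_integrable_exp_mul_hamiltonian_gibbsMeasure hω hl hβ.le γ N hT h2ϑ
  refine ⟨K ^ 2 * ∫ z, Real.exp (2 * (1 / (4 * T)) * P.hamiltonian N z) ∂π, c, hc,
    fun F hF B hB hFb t => ?_⟩
  have hFb' : ∀ y, |F y| ≤ B * Real.exp (1 / (4 * T) * P.hamiltonian N y) := fun y =>
    (hFb y).trans (le_mul_of_one_le_right hB (pinnedChain_one_le_exp_mul_hamiltonian hω hl hβ hϑ0.le y))
  have hpt : ∀ z, ((∫ y, F y ∂(P.transitionKernel N T T t z)) - ∫ y, F y ∂π) ^ 2 ≤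
      K ^ 2 * B ^ 2 * Real.exp (-(2 * c) * (t : ℝ)) *
        Real.exp (2 * (1 / (4 * T)) * P.hamiltonian N z) := by
    intro z
    have h := hb z t F hF B hB hFb'
    have e : K ^ 2 * B ^ 2 * Real.exp (-(2 * c) * (t : ℝ)) *
        Real.exp (2 * (1 / (4 * T)) * P.hamiltonian N z) =
        (K * B * Real.exp (1 / (4 * T) * P.hamiltonian N z) * Real.exp (-c * t)) ^ 2 := by
      rw [show (2 : ℝ) * (1 / (4 * T)) * P.hamiltonian N z =
          1 / (4 * T) * P.hamiltonian N z + 1 / (4 * T) * P.hamiltonian N z by ring, Real.exp_add,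
        show -(2 * c) * (t : ℝ) = -c * t + -c * t by ring, Real.exp_add]
      ring
    rw [e, ← sq_abs]
    exact pow_le_pow_left₀ (abs_nonneg _) h 2
  calc ∫ z, ((∫ y, F y ∂(P.transitionKernel N T T t z)) - ∫ y, F y ∂π) ^ 2 ∂π
      ≤ ∫ z, K ^ 2 * B ^ 2 * Real.exp (-(2 * c) * (t : ℝ)) *
          Real.exp (2 * (1 / (4 * T)) * P.hamiltonian N z) ∂π :=
        integral_mono_of_nonneg (Eventually.of_forall fun z => sq_nonneg _) (hI.const_mul _)
          (Eventually.of_forall hpt)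
    _ = K ^ 2 * (∫ z, Real.exp (2 * (1 / (4 * T)) * P.hamiltonian N z) ∂π) * B ^ 2 *
          Real.exp (-(2 * c) * (t : ℝ)) := by
        rw [integral_const_mul]
        ring

/-- **Dynkin in `L²(μ_T)`**: `∫ (P_t F - F)² dμ_T ≤ t² ∫ (L F)² dμ_T` for `F ∈ C_c^∞` and `t ≥ 0`
(integrated Dynkin identity against `g = P_tF - F`, Cauchy–Schwarz and the `L²(μ_T)` contraction on
`L F`). -/
theorem integral_sq_act_sub_le (hω : 0 < ω₂) (hl : 0 ≤ lam) (hβ : 0 < β) (hγ : 0 < γ)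
    (hN : 0 < N) (hT : 0 < T) {F : PhaseSpace N → ℝ} (hF : ContDiff ℝ ∞ F)
    (hFc : HasCompactSupport F) (t : ℝ≥0) :
    ∫ z, ((∫ y, F y ∂((pinnedChain ω₂ lam β γ).transitionKernel N T T t z)) - F z) ^ 2
        ∂((pinnedChain ω₂ lam β γ).gibbsMeasure N T) ≤
      (t : ℝ) ^ 2 * ∫ z, ((pinnedChain ω₂ lam β γ).generator N T T F z) ^ 2
        ∂((pinnedChain ω₂ lam β γ).gibbsMeasure N T) := by
  set P := pinnedChain ω₂ lam β γ with hP
  set π := P.gibbsMeasure N T with hπ_def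
  set κ := P.transitionKernel N T T with hκ_def
  haveI hprob : IsProbabilityMeasure π := pinnedChain_isProbabilityMeasure_gibbsMeasure hω hl hβ.le γ N hT
  have hinv : ∀ s : ℝ≥0, π.bind (κ s) = π := fun s =>
    pinnedChain_gibbsMeasure_bind_transitionKernel hω hl hβ.le hγ.le hN hT s
  have hF2 : ContDiff ℝ 2 F := hF.of_le (by norm_cast)
  set LF := P.generator N T T F with hLF_def
  have hLc : Continuous LF :=
    P.continuous_generator (pinnedChain_contDiff_U ω₂ lam β γ) (pinnedChain_contDiff_V ω₂ lam β γ) N T T hF2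
  have hLs : HasCompactSupport LF := P.hasCompactSupport_generator N T T hF2 hFc
  obtain ⟨CL, hCL⟩ := hLc.bounded_above_of_compact_support hLs
  obtain ⟨CF, hCF⟩ := hF.continuous.bounded_above_of_compact_support hFc
  have hCL0 : 0 ≤ CL := (norm_nonneg _).trans (hCL 0)
  -- `L²` data
  have hPF : MemLp (fun z => ∫ y, F y ∂(κ t z)) 2 π := memLp_act_of_bounded hω hl hβ hγ hF.continuous hCF t π
  have hFm : MemLp F 2 π := memLp_of_continuous_hasCompactSupport hF.continuous hFc π 2
  have hLm : MemLp LF 2 π := memLp_of_continuous_hasCompactSupport hLc hLs π 2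
  set g : PhaseSpace N → ℝ := fun z => (∫ y, F y ∂(κ t z)) - F z with hg_def
  have hg : MemLp g 2 π := hPF.sub hFm
  have hgmeas : Measurable g :=
    (hF.continuous.stronglyMeasurable.integral_kernel (κ := κ t)).measurable.sub hF.continuous.measurable
  -- integrated Dynkin against `g`
  have hdyn := pinnedChain_dynkin hω hl hβ.le hγ.le hN hT.le hT.le F hF hFc
  have hD := pinnedChain_integral_mul_act_sub_of_dynkin hω hl hβ.le hγ.le N T T π hinv hgmeas
    hF.continuous.measurable hLc.measurable hg.integrable_sq hFm.integrable_sq hLm.integrable_sq hdyn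
    (r := (t : ℝ)) t.coe_nonneg
  rw [Real.toNNReal_coe] at hD
  -- the left-hand side is `∫ g²`
  have iGP := (pinnedChain_integrable_mul_act_of_invariant hω hl hβ.le hγ.le N T T π t (hinv t) hgmeas
    hF.continuous.measurable hg.integrable_sq hFm.integrable_sq).1
  have iGF : Integrable (fun z => g z * F z) π := hg.integrable_mul hFm
  have hL : (∫ z, g z * (∫ y, F y ∂(κ t z)) ∂π) - ∫ z, g z * F z ∂π = ∫ z, g z ^ 2 ∂π := by
    rw [← integral_sub iGP iGF]
    exact integral_congr_ae (Eventually.of_forall fun z => by simp only [hg_def]; ring)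
  -- the right-hand side is at most `t √∫g² √∫(LF)²`
  have hϑ0 : 0 < 1 / (4 * T) := by positivity
  have h2ϑ : 2 * (1 / (4 * T)) < 1 / T := by
    rw [show (2 : ℝ) * (1 / (4 * T)) = 1 / (2 * T) by field_simp; ring]
    exact one_div_lt_one_div_of_lt hT (by linarith)
  have hLb : ∀ y, |LF y| ≤ CL * Real.exp (1 / (4 * T) * P.hamiltonian N y) := fun y =>
    ((Real.norm_eq_abs _).symm.le.trans (hCL y)).trans
      (le_mul_of_one_le_right hCL0 (pinnedChain_one_le_exp_mul_hamiltonian hω hl hβ hϑ0.le y))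
  have hbound : ∀ s ∈ Set.uIoc (0 : ℝ) t,
      ‖∫ z, g z * (∫ y, LF y ∂(κ s.toNNReal z)) ∂π‖ ≤
        Real.sqrt (∫ z, g z ^ 2 ∂π) * Real.sqrt (∫ z, LF z ^ 2 ∂π) := by
    intro s _
    have hPs : MemLp (fun z => ∫ y, LF y ∂(κ s.toNNReal z)) 2 π :=
      memLp_act_of_bounded hω hl hβ hγ hLc hCL _ π
    rw [Real.norm_eq_abs]
    refine (abs_integral_mul_le_sqrt_mul_sqrt π hg hPs).trans ?_
    refine mul_le_mul_of_nonneg_left (Real.sqrt_le_sqrt ?_) (Real.sqrt_nonneg _)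
    exact (pinnedChain_integral_sq_act_le hω hl hβ hγ hN hT hϑ0 h2ϑ hLc hLb s.toNNReal).2.2
  have hR := intervalIntegral.norm_integral_le_of_norm_le_const hbound
  rw [sub_zero, abs_of_nonneg t.coe_nonneg] at hR
  -- combine
  set G := ∫ z, g z ^ 2 ∂π with hG_def
  set M := Real.sqrt (∫ z, LF z ^ 2 ∂π) with hM_def
  have hG0 : 0 ≤ G := integral_nonneg fun z => sq_nonneg _
  have hM0 : 0 ≤ M := Real.sqrt_nonneg _
  have h1 : G ≤ (t : ℝ) * M * Real.sqrt G := by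
    have h := hD
    rw [hL] at h
    calc G = _ := h
      _ ≤ _ := Real.le_norm_self _
      _ ≤ Real.sqrt G * M * (t : ℝ) := hR
      _ = (t : ℝ) * M * Real.sqrt G := by ring
  have h2 : Real.sqrt G ≤ (t : ℝ) * M := by
    by_cases h0 : Real.sqrt G = 0
    · rw [h0]
      exact mul_nonneg t.coe_nonneg hM0
    · have hpos : 0 < Real.sqrt G := lt_of_le_of_ne (Real.sqrt_nonneg _) (Ne.symm h0)
      have h3 : Real.sqrt G * Real.sqrt G ≤ (t : ℝ) * M * Real.sqrt G := by
        rw [Real.mul_self_sqrt hG0]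
        exact h1
      exact le_of_mul_le_mul_right h3 hpos
  calc G = (Real.sqrt G) ^ 2 := (Real.sq_sqrt hG0).symm
    _ ≤ ((t : ℝ) * M) ^ 2 := pow_le_pow_left₀ (Real.sqrt_nonneg _) h2 2
    _ = (t : ℝ) ^ 2 * ∫ z, LF z ^ 2 ∂π := by
        rw [mul_pow, hM_def, Real.sq_sqrt (integral_nonneg fun z => sq_nonneg _)]

/-! ### Registered helper sub-goal (stub form, one line) -/

/-- Registered helper sub-goal `helper_responseDensityNoisyDynkinL2` of stub `stub_responseDensityNoisy`
(= `integral_sq_act_sub_le` in stub form): Dynkin in `L²(μ_T)`, `‖P_t F - F‖₂ ≤ t ‖L F‖₂` for test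
functions. -/
theorem helper_responseDensityNoisyDynkinL2 : ∀ ω₂ lam β γ : ℝ, 0 < ω₂ → 0 ≤ lam → 0 < β → 0 < γ → ∀ (N : ℕ), 0 < N → ∀ (T : ℝ), 0 < T → ∀ F : Literature.MathematicalPhysics.KineticTheory.HeatConduction.PhaseSpace N → ℝ, ContDiff ℝ ((⊤ : ℕ∞) : WithTop ℕ∞) F → HasCompactSupport F → ∀ t : NNReal, ∫ z, ((∫ y, F y ∂((Literature.MathematicalPhysics.KineticTheory.HeatConduction.pinnedChain ω₂ lam β γ).transitionKernel N T T t z)) - F z) ^ 2 ∂((Literature.MathematicalPhysics.KineticTheory.HeatConduction.pinnedChain ω₂ lam β γ).gibbsMeasure N T) ≤ (t : ℝ) ^ 2 * ∫ z, ((Literature.MathematicalPhysics.KineticTheory.HeatConduction.pinnedChain ω₂ lam β γ).generator N T T F z) ^ 2 ∂((Literature.MathematicalPhysics.KineticTheory.HeatConduction.pinnedChain ω₂ lam β γ).gibbsMeasure N T) :=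
  fun _ _ _ _ hω hl hβ hγ _ hN _ hT _ hF hFc t => integral_sq_act_sub_le hω hl hβ hγ hN hT hF hFc t

end Summit.AtomisticToContinuum.FouriersLaw.Theorems.NoiseLocality.StubResponseDensityNoisy

end
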